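import Mathlib
import Literature.Analysis.FluidPDE.SelfSimilar
import Literature.Analysis.FluidPDE.SpaceTimeRescaling
import Literature.Analysis.FluidPDE.ScalingUniformRecurrence
import HarnessLib

/-!
# Increment tools for the Giga–Kohn harvest (crux `RecurrentLiouville`, line `Sketch`, stub S3)

The line `Sketch` (skeleton v6) of the crux `RecurrentLiouville` (stmt-NavierStokesRegularity-1589)
studies the LOCAL INCREMENT FUNCTIONAL of the Navier–Stokes scaling orbit
`c ↦ u_c = nsRescale c u`, `u_c (t, x) = c u (c² t, c x)`:

`I(u; c, R) := ∫⁻_{(−2,−1) × B_R} ‖c u(c²t, cx) − u(t,x)‖ₑ²`.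

This file proves the two measure-theoretic tools registered as the stub `stub_gkIncrementTools`:

* (i) `gkTools_increment_zoom` — covariance under the parabolic zoom `u ↦ nsRescale λ u`:
  pointwise `nsRescale c (nsRescale λ u) = λ • (nsRescale c u) ∘ Φ_λ`, `Φ_λ (t, x) = (λ² t, λ x)`
  (`stAffine (λ²) λ 0 0`), so the increments of the zoomed field on `(−2,−1) × B_R` are `λ²`
  (from the prefactor) times `λ⁻⁵` (Jacobian of `Φ_λ` on `ℝ × ℝ³`) times those of `u` on
  `(−2λ², −λ²) × B_{λR}` (`setLIntegral_preimage_comp_stAffine`).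
* (ii) `gkTools_increment_congr_ae` — fields equal a.e. on the open slab `{t < 0} × ℝ³` have the
  same increments: the dilation `Φ_c` is non-singular (`ae_restrict_preimage_stAffine`) and
  preserves the slab (`stAffine_sq_preimage_Iio_prod_univ`), and the box lies in the slab.

Both are folklore changes of variables; no Navier–Stokes input.
-/

noncomputable section

-- the sub-problem namespace repeats the summit name (D-0017 layout `Summit.<S>.<P>.Theorems`)
set_option linter.dupNamespace false

namespace Summit.NavierStokesRegularity.NavierStokesRegularity.Theorems

open MeasureTheory Set Function Filter Topology TopologicalSpace Metric
open Literature.Analysis Literature.Analysis.FluidPDE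
open scoped NNReal ENNReal

/-! ## (i) Zoom covariance -/

/-- Pointwise form of the zoom covariance: with `Φ_λ = stAffine (λ²) λ 0 0`,
`‖(u_λ)_c − u_λ‖ₑ² (z) = λ² · ‖u_c − u‖ₑ² (Φ_λ z)` (`λ ≥ 0`; the two rescalings commute). [folklore] -/
theorem gkTools_integrand_zoom (u : ℝ → EuclideanSpace ℝ (Fin 3) → EuclideanSpace ℝ (Fin 3))
    {lam : ℝ} (hlam : 0 ≤ lam) (c : ℝ) (z : ℝ × EuclideanSpace ℝ (Fin 3)) :
    ‖nsRescale c (nsRescale lam u) z.1 z.2 - nsRescale lam u z.1 z.2‖ₑ ^ 2 =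
      ENNReal.ofReal (lam ^ 2) *
        ‖nsRescale c u (stAffine (lam ^ 2) lam 0 (0 : EuclideanSpace ℝ (Fin 3)) z).1
              (stAffine (lam ^ 2) lam 0 (0 : EuclideanSpace ℝ (Fin 3)) z).2 -
            u (stAffine (lam ^ 2) lam 0 (0 : EuclideanSpace ℝ (Fin 3)) z).1
              (stAffine (lam ^ 2) lam 0 (0 : EuclideanSpace ℝ (Fin 3)) z).2‖ₑ ^ 2 := by
  simp only [nsRescale_apply, stAffine_fst, stAffine_snd, zero_add]
  have key : c • lam • u (lam ^ 2 * (c ^ 2 * z.1)) (lam • c • z.2) -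
      lam • u (lam ^ 2 * z.1) (lam • z.2) =
      lam • (c • u (c ^ 2 * (lam ^ 2 * z.1)) (c • lam • z.2) - u (lam ^ 2 * z.1) (lam • z.2)) := by
    rw [smul_sub, smul_comm lam c (u _ _), mul_left_comm (lam ^ 2) (c ^ 2) z.1, smul_comm lam c z.2]
  rw [key, enorm_smul, mul_pow, Real.enorm_eq_ofReal hlam, ← ENNReal.ofReal_pow hlam]

/-- The unit box is the `Φ_λ`-preimage of the dilated box:
`Φ_λ ⁻¹' ((−2λ², −λ²) × B_{λR}) = (−2, −1) × B_R` for `λ > 0`. [folklore] -/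
theorem gkTools_preimage_box {lam : ℝ} (hlam : 0 < lam) (R : ℝ) :
    stAffine (lam ^ 2) lam 0 (0 : EuclideanSpace ℝ (Fin 3)) ⁻¹'
        (Ioo (-2 * lam ^ 2) (-lam ^ 2) ×ˢ ball (0 : EuclideanSpace ℝ (Fin 3)) (lam * R)) =
      Ioo (-2 : ℝ) (-1) ×ˢ ball (0 : EuclideanSpace ℝ (Fin 3)) R := by
  have hlam2 : 0 < lam ^ 2 := by positivity
  rw [stAffine_preimage_cylinder hlam2 hlam]
  congr 1
  · rw [sub_zero, sub_zero, mul_div_assoc, div_self hlam2.ne', mul_one, neg_div,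
      div_self hlam2.ne']
  · rw [sub_zero, smul_zero, mul_div_cancel_left₀ R hlam.ne']

/-- Bookkeeping of the scaling constants: `λ² · (λ² λ³)⁻¹ = λ⁻³` in `ℝ≥0∞` (`λ > 0`). [folklore] -/
theorem gkTools_zoom_const {lam : ℝ} (hlam : 0 < lam) :
    ENNReal.ofReal (lam ^ 2) * ENNReal.ofReal (lam ^ 2 * lam ^ 3)⁻¹ =
      ENNReal.ofReal (lam ^ 3)⁻¹ := by
  rw [← ENNReal.ofReal_mul (sq_nonneg lam)]
  congr 1
  field_simp

/-- **Zoom covariance of the local increment functional**: for `λ > 0` and any `c`,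
`∫⁻_{(−2,−1)×B_R} ‖(u_λ)_c − u_λ‖ₑ² = λ⁻³ ∫⁻_{(−2λ²,−λ²)×B_{λR}} ‖u_c − u‖ₑ²`
(pointwise `(u_λ)_c − u_λ = λ • (u_c − u) ∘ Φ_λ`, change of variables `z ↦ Φ_λ z` with Jacobian
`λ⁵` on `ℝ × ℝ³`). [folklore] -/
theorem gkTools_increment_zoom
    (u : ℝ → EuclideanSpace ℝ (Fin 3) → EuclideanSpace ℝ (Fin 3)) (lam c R : ℝ)
    (hlam : 0 < lam) :
    ∫⁻ z in Ioo (-2 : ℝ) (-1) ×ˢ Metric.ball (0 : EuclideanSpace ℝ (Fin 3)) R,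
        ‖nsRescale c (nsRescale lam u) z.1 z.2 - nsRescale lam u z.1 z.2‖ₑ ^ 2 =
      ENNReal.ofReal (lam ^ 3)⁻¹ *
        ∫⁻ z in Ioo (-2 * lam ^ 2) (-lam ^ 2) ×ˢ
            Metric.ball (0 : EuclideanSpace ℝ (Fin 3)) (lam * R),
          ‖nsRescale c u z.1 z.2 - u z.1 z.2‖ₑ ^ 2 := by
  have hlam2 : 0 < lam ^ 2 := by positivity
  set G : ℝ × EuclideanSpace ℝ (Fin 3) → ℝ≥0∞ :=
    fun w => ‖nsRescale c u w.1 w.2 - u w.1 w.2‖ₑ ^ 2 with hG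
  have hF : (fun z : ℝ × EuclideanSpace ℝ (Fin 3) =>
      ‖nsRescale c (nsRescale lam u) z.1 z.2 - nsRescale lam u z.1 z.2‖ₑ ^ 2) =
      fun z => ENNReal.ofReal (lam ^ 2) *
        G (stAffine (lam ^ 2) lam 0 (0 : EuclideanSpace ℝ (Fin 3)) z) := by
    funext z
    rw [gkTools_integrand_zoom u hlam.le c z]
  rw [show (∫⁻ z in Ioo (-2 : ℝ) (-1) ×ˢ Metric.ball (0 : EuclideanSpace ℝ (Fin 3)) R,
      ‖nsRescale c (nsRescale lam u) z.1 z.2 - nsRescale lam u z.1 z.2‖ₑ ^ 2) =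
      ∫⁻ z in Ioo (-2 : ℝ) (-1) ×ˢ Metric.ball (0 : EuclideanSpace ℝ (Fin 3)) R,
        ENNReal.ofReal (lam ^ 2) * G (stAffine (lam ^ 2) lam 0 (0 : EuclideanSpace ℝ (Fin 3)) z)
      from by rw [hF]]
  rw [lintegral_const_mul' _ _ ENNReal.ofReal_ne_top, ← gkTools_preimage_box hlam R,
    setLIntegral_preimage_comp_stAffine (E := EuclideanSpace ℝ (Fin 3)) hlam2 hlam 0 0 G,
    finrank_euclideanSpace_fin, ← mul_assoc, gkTools_zoom_const hlam]

/-! ## (ii) Congruence under a.e.-modification on the open slab -/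

/-- The unit box `(−2,−1) × B_R` lies in the open slab `{t < 0} × ℝ³`. [folklore] -/
theorem gkTools_box_subset_slab (R : ℝ) :
    Ioo (-2 : ℝ) (-1) ×ˢ ball (0 : EuclideanSpace ℝ (Fin 3)) R ⊆
      Iio (0 : ℝ) ×ˢ (univ : Set (EuclideanSpace ℝ (Fin 3))) :=
  prod_mono (fun _ ht => lt_trans ht.2 (by norm_num)) (subset_univ _)

/-- **The increment functional does not see null sets**: if `u = v` a.e. on the open slab
`{t < 0} × ℝ³`, then for every `c > 0` and `R` the increments of `u` and `v` on `(−2,−1) × B_R`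
coincide (the dilation `Φ_c` is non-singular and preserves the slab, so also `u ∘ Φ_c = v ∘ Φ_c`
a.e. there). [folklore] -/
theorem gkTools_increment_congr_ae
    (u v : ℝ → EuclideanSpace ℝ (Fin 3) → EuclideanSpace ℝ (Fin 3)) (c R : ℝ) (hc : 0 < c)
    (h : ∀ᵐ z ∂(volume.restrict (Iio (0 : ℝ) ×ˢ (univ : Set (EuclideanSpace ℝ (Fin 3))))),
      uncurry u z = uncurry v z) :
    ∫⁻ z in Ioo (-2 : ℝ) (-1) ×ˢ Metric.ball (0 : EuclideanSpace ℝ (Fin 3)) R,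
        ‖nsRescale c u z.1 z.2 - u z.1 z.2‖ₑ ^ 2 =
      ∫⁻ z in Ioo (-2 : ℝ) (-1) ×ˢ Metric.ball (0 : EuclideanSpace ℝ (Fin 3)) R,
        ‖nsRescale c v z.1 z.2 - v z.1 z.2‖ₑ ^ 2 := by
  have hc2 : 0 < c ^ 2 := by positivity
  -- transport the a.e. equality along the dilation `Φ_c`, which preserves the slab
  have hΦ := ae_restrict_preimage_stAffine hc2 hc 0 (0 : EuclideanSpace ℝ (Fin 3)) h
  rw [stAffine_sq_preimage_Iio_prod_univ hc.ne'] at hΦ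
  have h1 := ae_restrict_of_ae_restrict_of_subset (gkTools_box_subset_slab R) h
  have h2 := ae_restrict_of_ae_restrict_of_subset (gkTools_box_subset_slab R) hΦ
  refine lintegral_congr_ae ?_
  filter_upwards [h1, h2] with z hz1 hz2
  simp only [Function.uncurry, stAffine_fst, stAffine_snd, zero_add] at hz1 hz2
  simp only [nsRescale_apply, hz1, hz2]

/-! ## The registered stub -/

/-- **Increment tools** (stub S3 of line `Sketch`, skeleton v6, crux `RecurrentLiouville`).
(i) Zoom covariance of the local increment functional:
`nsRescale c (nsRescale λ u) = λ • (nsRescale c u) ∘ Φ_λ`, `Φ_λ(t,x) = (λ²t, λx)`, so the increments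
of the zoomed field on `(−2,−1) × B_R` are `λ^{-3}` times those of `u` on `(−2λ², −λ²) × B_{λR}`
(change of variables, Jacobian `λ⁵`).  (ii) Fields equal a.e. on the open slab have the same
increments (the dilation is non-singular). [folklore] -/
theorem stub_gkIncrementTools :
    (∀ (u : ℝ → EuclideanSpace ℝ (Fin 3) → EuclideanSpace ℝ (Fin 3)) (lam c R : ℝ),
      0 < lam → 0 < c →
        ∫⁻ z in Ioo (-2 : ℝ) (-1) ×ˢ Metric.ball (0 : EuclideanSpace ℝ (Fin 3)) R,
            ‖nsRescale c (nsRescale lam u) z.1 z.2 - nsRescale lam u z.1 z.2‖ₑ ^ 2 =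
          ENNReal.ofReal (lam ^ 3)⁻¹ *
            ∫⁻ z in Ioo (-2 * lam ^ 2) (-lam ^ 2) ×ˢ
                Metric.ball (0 : EuclideanSpace ℝ (Fin 3)) (lam * R),
              ‖nsRescale c u z.1 z.2 - u z.1 z.2‖ₑ ^ 2) ∧
    (∀ (u v : ℝ → EuclideanSpace ℝ (Fin 3) → EuclideanSpace ℝ (Fin 3)) (c R : ℝ), 0 < c →
      (∀ᵐ z ∂(volume.restrict (Iio (0 : ℝ) ×ˢ (univ : Set (EuclideanSpace ℝ (Fin 3))))),
        uncurry u z = uncurry v z) →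
        ∫⁻ z in Ioo (-2 : ℝ) (-1) ×ˢ Metric.ball (0 : EuclideanSpace ℝ (Fin 3)) R,
            ‖nsRescale c u z.1 z.2 - u z.1 z.2‖ₑ ^ 2 =
          ∫⁻ z in Ioo (-2 : ℝ) (-1) ×ˢ Metric.ball (0 : EuclideanSpace ℝ (Fin 3)) R,
            ‖nsRescale c v z.1 z.2 - v z.1 z.2‖ₑ ^ 2) :=
  ⟨fun u lam c R hlam _ => gkTools_increment_zoom u lam c R hlam, gkTools_increment_congr_ae⟩

end Summit.NavierStokesRegularity.NavierStokesRegularity.Theorems
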